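import Summits.BirchSwinnertonDyer.BirchSwinnertonDyer.Theorems.SignedLowerHalvesKobayashiLowerHalfLargeImagePairedDescent
import Literature.NumberTheory.EllipticCurves.PlusMinusPAdicLFunctionProofs
import HarnessLib

/-!
# The landed paired-twist door at the (def) twist parameter `d = -D` — the support stub `stub_pairedDoor`
# of line `lower-chamber-door` modulo its NAMED PUBLISHED inputs (crux 3 `KobayashiLowerHalfLargeImage`, item
# stmt-BirchSwinnertonDyer-19001, route `SignedLowerHalves`; cell `bsd-ssimc`, lead seat `bsd-line-slh-p1` gen 15)

Companion of `…LargeImageDefField` (p721256: `stub_defField` discharged). The published, triaged (round 1: 2/2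
PASS) but UNREGISTERED line `Cruxes/KobayashiLowerHalfLargeImage/Lines/lower_chamber_door.lean` separates the
factor of `W` from its engine's PAIRED lower half `L_p^ε(E)·L_p^ε(E^{(-D)}) ∣ char X^ε(E)·char X^ε(E^{(-D)})`
through the tree's door `X7.kobayashiLowerDivisibility_of_paired_twist` (`…LargeImagePairedDescent`); its stub
`stub_pairedDoor : PairedDoorStatement` is that door at the twist parameter `d = -D`, `D` a prime `≠ p`,
`p ≥ 5`. This file proves `PairedDoorStatement` — body VERBATIM (the `Cruxes/…/Lines` module is a workfile, not
an importable olean) — GRANTED exactly the named PUBLISHED facts the door consumes: Kobayashi 2003 Thm. 1.2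
(`h12`) / Thm. 4.1 (`h41`), modularity (`hmod`), the period units (`h5`, `h3`), Wuthrich 2014 Lemma 20 (`hL20`);
Pollack's theorem is a tree THEOREM (`pollack_exists_plusMinusPAdicLFunction_holds`) and is DISCHARGED here (the
line's in-file `pairedDoor_of_pub` still carried it as a hypothesis). The twist parameter is admissible:
`-D` is squarefree and `p ∤ 2·(-D)` (`p ≥ 5`, `D ≠ p` prime). In the VARIANT-N registry shape (director-bsd
(390)) a registration of the line would therefore carry `stub_pairedDoor` as an in-file `…_closed` theorem over
a cite stub `{h12, h41, hmod, h5, h3, hL20}`, not as a content stub.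

HONEST FRAMING (D-0152, cell bsd-ssimc): a SUPPORT statement (size XS: bookkeeping around a landed door) of
an unregistered line; CONDITIONAL on the displayed named facts; touches neither that line's engine
`stub_lowerChamber`, nor the line of record `kurihara_rigidity`, nor the crux, nor the route; nothing is
booked; BSD is not proved by any of this. `--supports stmt-BirchSwinnertonDyer-19001` (helper). No definition,
no named fact minted, no sorry.

References: [Kobayashi2003] Thm. 1.2 (p. 2), Thm. 4.1 (p. 8), Conjecture (p. 2); [Pollack2003] Prop. 6.18;
[Wuthrich2014] Lemma 20 (p. 399); [BurungaleSkinnerTianWan2024] Thm. 2.5 (def) (the chamber). Crux dir: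
`Lines/lower_chamber_door.{lean,md}` (k1 g23 / cruxplan g0), `TRIAGE-r1-1.md`, `TRIAGE-r1-2.md`.
-/

set_option autoImplicit false
-- single-problem summit (D-0017): the doubled namespace component is by design
set_option linter.dupNamespace false

noncomputable section

open scoped Classical MatrixGroups ModularForm

open CongruenceSubgroup WeierstrassCurve Literature.NumberTheory.EllipticCurves
  Literature.NumberTheory.EllipticCurves.ModularForms
  Literature.NumberTheory.EllipticCurves.Rank1Residual Literature.NumberTheory.EllipticCurves.Kobayashi2003
  Literature.NumberTheory.EllipticCurves.Rank1Residual.Typed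
  Summit.BirchSwinnertonDyer.Rank1Residual.Supersingular

namespace Summit.BirchSwinnertonDyer.BirchSwinnertonDyer.Theorems.LowerChamberDoor

/-- **The (def) twist parameter is admissible for the door**: for primes `p ≥ 5` and `D ≠ p`, `-D` is
squarefree and `p ∤ 2·(-D)`. (VERBATIM the line's in-file `twistParam_admissible`.) [folklore] -/
theorem twistParam_admissible {p D : ℕ} (hp : p.Prime) (hp5 : 5 ≤ p) (hD : D.Prime) (hDp : D ≠ p) :
    Squarefree (-(D : ℤ)) ∧ ¬ (p : ℤ) ∣ 2 * (-(D : ℤ)) := by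
  refine ⟨?_, ?_⟩
  · rw [← Int.squarefree_natAbs]
    simpa using hD.prime.squarefree
  · intro h
    rw [mul_neg, dvd_neg] at h
    have h' : p ∣ 2 * D := by exact_mod_cast h
    rcases (Nat.Prime.dvd_mul hp).1 h' with h2 | hd
    · have := Nat.le_of_dvd (by norm_num) h2
      omega
    · exact hDp ((Nat.prime_dvd_prime_iff_eq hp hD).1 hd).symm

/-- **`stub_pairedDoor` of line `lower-chamber-door` — its statement `PairedDoorStatement` VERBATIM — GRANTED
the door's named PUBLISHED inputs** `h12` (Kobayashi Thm. 1.2), `h41` (Kobayashi Thm. 4.1), `hmod`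
(modularity), `h5` / `h3` (period units), `hL20` (Wuthrich Lemma 20); Pollack's theorem DISCHARGED by the tree
theorem `pollack_exists_plusMinusPAdicLFunction_holds`. At an X7 pair `(W, p)`, `p ≥ 5`, `a_p = 0`, `ρ̄` onto,
for a prime `D ≠ p` and a globally minimal model `W'` of `W^{(-D)}`: the PAIRED lower half for `(W, W')` and a
sign `ε` gives `KobayashiLowerDivisibility W p ε`. ONE application of `X7.kobayashiLowerDivisibility_of_paired_twist`
with `twistParam_admissible`. CONDITIONAL on the displayed facts; closes nothing.
[cite: Kobayashi2003, Thm. 1.2 (p. 2), Thm. 4.1 (p. 8) and Conjecture (p. 2)] [cite: Pollack2003, Prop. 6.18]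
[cite: Wuthrich2014, Lemma 20 (p. 399)] -/
theorem pairedDoorStatement_of_facts
    (h12 : Kobayashi2003.thm12_signedSelmerDual_finite_torsion)
    (h41 : Kobayashi2003.thm41_signedCharIdeal_divisibility)
    (hmod : nonempty_modularParametrizationData)
    (h5 : realPeriodRat_eq_unit_mul_plusPeriod) (h3 : realPeriodRat_eq_unit_mul_plusPeriod_three)
    (hL20 : Wuthrich2014.lemma20_surjective_threeAdic_of_semistable) :
    ∀ (W : WeierstrassCurve ℚ) [W.IsElliptic] [W.IsGloballyMinimal] (p : ℕ) [Fact p.Prime],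
      5 ≤ p → ClassX7 W p → W.frobeniusTrace p = 0 → Surj W p →
      ∀ (D : ℕ), D.Prime → D ≠ p →
      ∀ (W' : WeierstrassCurve ℚ) [W'.IsElliptic] [W'.IsGloballyMinimal] (C : VariableChange ℚ),
        C • W' = W.quadraticTwist ((-(D : ℤ) : ℤ) : ℚ) →
      ∀ ε : ℤˣ, PairedKobayashiLowerDivisibility W W' p ε → KobayashiLowerDivisibility W p ε := by
  intro W _ _ p _ hp5 hX hap hs D hD hDp W' _ _ C hC ε hpair
  have hp : p ≠ 2 := by omega
  obtain ⟨hd, hpd⟩ := twistParam_admissible (Fact.out : p.Prime) hp5 hD hDp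
  exact X7.kobayashiLowerDivisibility_of_paired_twist W W' p h12 h41
    (fun {_} _ {_} ↦ pollack_exists_plusMinusPAdicLFunction_holds) hmod h5 h3 hL20 hp hX hap hs hd hpd hC
    hpair

end Summit.BirchSwinnertonDyer.BirchSwinnertonDyer.Theorems.LowerChamberDoor

end
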